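import Summits.BirchSwinnertonDyer.BirchSwinnertonDyer.Theorems.EisensteinPrimesBSDpOnCellCResidualV11
import Literature.NumberTheory.EllipticCurves.TwoVariableSelmerDual
import HarnessLib

/-!
# Route `EisensteinPrimes`, crux 4 `BSDpOnCellC` (stmt-BirchSwinnertonDyer-19034), line «accum» ∩ line «crystal»: the ONE typed statement
# line «accum» posits — the sign-free two-variable rational Kolyvagin-direction divisibility at the p-new point, `TwoVarRatDivPNew W p` —
# as an importable module (definition; cell `bsd-eis`, LEAD `cruxlead-19034` g0; text VERBATIM from ideator bsd-idea-12 g15's workfile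
# `Cruxes/BSDpOnCellC/Lines/accum.lean` v1.3 §1, commit ba498f719a24; `--supports stmt-BirchSwinnertonDyer-19034`)

WHY THIS FILE. Line «accum» (idea card `Ideas/accum.md`, critic V95 PASS-WITH-PRICE 0 strikes, prices paid r1.2/r1.3) replaces the record's
stub `stub_divRbeta` (road R-β at `𝔭̄`, both signs: `X2.{Nonsplit,Split}KolyvaginDivOnTreeIntOther` — the rational Kolyvagin-direction
divisibility no printed Euler/Kolyvagin system gives at a residually reducible `p ‖ N`) by `stub_twoVarRatDivPNew : ∀ W p, CellC W p →
TwoVarRatDivPNew W p` (load-bearing; intended proof = the accumulation lemma `Accum.AccumulationLemma₂U`, PROVED sorry-free in the workfile,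
∘ member-wise two-variable divisibilities at the good-ordinary crystalline members ∘ fibre control) and `stub_acDescent` (descent to the
anticyclotomic line `T₁ = 0`). The predicate is DECLARED LOCALLY in that workfile; a workfile is not a tree module, so the REGISTERED skeleton
(line «crystal», `Lines/crystal.lean`, LEAD) cannot state those two stubs BY NAME until the predicate lives in an importable module with the
same meaning. This file is that module: the predicate VERBATIM (binders and body unchanged; `W`, `p` made explicit parameters), + its
`Iff.rfl` unfolding lemma, nothing else. The accumulation lemma and its proof stay in the workfile (they are the INTENDED PROOF of the stub, not
part of its statement) until a prover lands them under `Theorems/`.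

HONEST FRAMING. ONE definition (a `Prop` with parameters `W`, `p`, tagged `@[conjecture]` = open typed statement / obligation node, like
`X2.NonsplitKolyvaginDivOnTreeIntOther`); no named fact, no instance, no notation, no `sorry`. Nothing about any curve, Selmer group or
`p`-adic `L`-function is asserted; whether `TwoVarRatDivPNew W p` HOLDS on X2c is exactly the stub, claimed nowhere in the tree. PRINT STATUS of
the statement: NOT in print at a reducible `p ‖ N` (two-variable divisibilities in print — BSTW arXiv:2409.01350 Thm. 10.5, Yan–Zhu 2026 Thm. 4.2 —
carry `p ∤ 2N` and irreducibility; CGS 2025 Thm. 3.3.1 is weight 2, `p ∤ N`); it is the UNPINNED rational half of Burungale–Castella–Skinner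
Conj. 4.1.2 at `p ‖ N` read on the `κ`-line (see the docstring: `L₂` is a witness variable).

References: [CastellaGrossiSkinner2025] Thm. 3.3.1, Def. 2.4.3 (arXiv:2303.04373v3); [BurungaleCastellaSkinner2025] §2.1, Conj. 4.1.2
(arXiv:2405.00270v2); [Castella2018Exceptional] Thms. 2.10–2.11; [Ochiai2006] Def. 7.1, Lemma 7.2; tree `Literature/…/TwoVariableSelmerDual.lean`
(`XGr₂`, `XGr₂.charIdeal`, `IwasawaAlgebra₂`, `IsTopGeneratorPair`), `X11b/RouteR1IntReceptacle` (`R1.IsBDPLFunctionInt`), workfile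
`Cruxes/BSDpOnCellC/Lines/accum.lean` §1 (source of the text), `Lines/accum.md`, `Ideas/accum.md`.
-/

set_option autoImplicit false
set_option linter.dupNamespace false

noncomputable section

open scoped Classical MatrixGroups ModularForm

open CongruenceSubgroup WeierstrassCurve NumberField IsDedekindDomain Field PowerSeries
  Literature.NumberTheory.EllipticCurves Literature.NumberTheory.EllipticCurves.GreenbergSelmer
  Literature.NumberTheory.EllipticCurves.ModularForms Literature.NumberTheory.QuadraticFields
  Literature.NumberTheory.EllipticCurves.Rank1Residual
  Literature.NumberTheory.EllipticCurves.Rank1Residual.Typed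
  Literature.NumberTheory.EllipticCurves.KrizLi2019
  Literature.NumberTheory.EllipticCurves.GreenbergVatsal2000
  Literature.NumberTheory.EllipticCurves.Wuthrich2014
  Literature.NumberTheory.EllipticCurves.SteinWuthrich2013
  Literature.NumberTheory.EllipticCurves.Castella2018Exceptional
  Literature.NumberTheory.GaloisRepresentations Literature.NumberTheory.GaloisCohomology
  Literature.NumberTheory.Automorphic
  Summit.BirchSwinnertonDyer.Rank1Residual.X11b.AcSelmer
  Summit.BirchSwinnertonDyer.Rank1Residual.X11b.Halves
  Summit.BirchSwinnertonDyer.Rank1Residual.X11b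
  Summit.BirchSwinnertonDyer.Rank1Residual Summit.BirchSwinnertonDyer.Rank1Residual.X1
  Summit.BirchSwinnertonDyer.Rank1Residual.X2
open Literature.NumberTheory.EllipticCurves.KellerYin2024 (curveLocalLambda)



namespace Summit.BirchSwinnertonDyer.BirchSwinnertonDyer.Theorems.EisensteinPrimesBSDpOnCellCAccumDefs

/-- **`TwoVarRatDivPNew W p` — rational two-variable Kolyvagin divisibility of a lift of the ♭-frame, at the
`p`-new point, SIGN-FREE.** Binders: those of `X2.NonsplitKolyvaginDivOnTreeIntOther W p` VERBATIM minus the sign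
hypothesis, then a cyclotomic `κ₁ : ZpExtension K p` and `γ₁` with `(γ₁, γ)` an adapted generator pair of
`(κ₁, κ)` (`ZpExtension.IsTopGeneratorPair`: in particular `κ(γ₁) = 0`, so `T₁ = 0` is the `κ`-line and
`PowerSeries.constantCoeff` is the restriction to it). Conclusion: `X_Gr(E_K/K̃_∞)` (unramified above `𝔭̄`) is a
finitely generated TORSION `Λ₂`-module (so that the tree's `Module.charIdeal` is the genuine product of height-one
primes, not its junk value `⊤`) and `∃ L₂ c e u`, `u` a unit of `𝓞_{ℂ_p}⟦T⟧`,
`p^c·L₂ ∈ ch_{Λ₂}(X_Gr(E_K/K̃_∞) unr. above 𝔭̄)·𝓞_{ℂ_p}⟦T₁⟧⟦T₂⟧` and `L₂(0,T)·u = p^e·Q`.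
WHAT THE STATEMENT SAYS EXACTLY (critic V95 P2, paid v1.2 — decl name kept): since `L₂, c, e, u` are EXISTENTIAL, the
`∃`-clause is EQUIVALENT to «the `T₁ = 0` specialisation of (the `𝓞_{ℂ_p}`-extension of) `ch_{Λ₂}(X_Gr)` contains
`p^{e'}·Q·u⁻¹` for some `e'` and some unit `u`», i.e. `π(ch_{Λ₂} X_Gr) ∣ p^{e'}·Q` up to a unit of `𝓞_{ℂ_p}⟦T⟧`
(given `p^c L₂ = ch·M`, put `T₁ = 0`; conversely lift `M(0,T)` constantly). So `L₂` is a WITNESS VARIABLE, not a pinned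
two-variable `p`-adic `L`-function, and `TwoVarRatDivPNew` is «torsion of `X_Gr` + rational divisibility of its `κ`-LINE
characteristic series into the ♭-frame», nothing more. The PINNED version — `L₂` = the unit-normalised two-variable
Greenberg/BDP function of `f_E` over `K` (CGS Def. 2.4.3 shape at a `p`-new form, the `p`-adic limit of the members'
along `f_E`'s étale branch; `κ`-line restriction = the ♭-frame up to `p^e·unit`: CGS prop. `comp-Lac` for members,
Castella JIMJ 2020 Thm. 1.4 / `Castella2018Exceptional` Thms. 2.10–2.11 in the limit) — would be the rational half of
Burungale–Castella–Skinner Conj. 4.1.2 at `p ‖ N`; it is what the intended PROOF produces (the accumulation lemma is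
applied to that `L₂`), but the stub does not, and need not, pin it. HYPOTHESIS-SHAPED; nothing asserted. Print status:
NOT in print at a reducible `p ‖ N`
(two-variable divisibilities in print: BSTW arXiv:2409.01350 Thm. 10.5 and Yan–Zhu 2026 Thm. 4.2 carry `p ∤ 2N` and
(irr); CGS 2025 Thm. 3.3.1 is weight 2, `p ∤ N`).
[cite: CastellaGrossiSkinner2025, Thm. 3.3.1 and its proof (arXiv:2303.04373v3 p. 18: Rubin's `Hyp(K_∞,V)` (i)(ii) in place of a big-image hypothesis) and Def. 2.4.3]
[cite: BurungaleCastellaSkinner2025, §2.1 (p. 6) and Conj. 4.1.2 (the module `X_Gr(E/K_∞)`)]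
[cite: Castella2018Exceptional, Thm. 2.10 and Thm. 2.11 (arXiv:1507.04260 pp. 13–14)] -/
@[conjecture] def TwoVarRatDivPNew (W : WeierstrassCurve ℚ) [W.IsElliptic] [W.IsGloballyMinimal] (p : ℕ) [Fact p.Prime] : Prop :=
  ∀ (N : ℕ) [NeZero N] (K : Type) [Field K] [NumberField K] (Dt : ModularParametrizationData W N)
    (H : HeegnerDatum N (NumberField.discr K)) (ιK : K →+* ℂ) (P : (W.baseChange K).toAffine.Point),
    CellC W p → W.conductorNorm ℤ = N →
    IsImaginaryQuadratic K → NumberField.discr K < -4 → SatisfiesHeegnerHypothesis N K →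
    (W.quadraticTwist (NumberField.discr K : ℚ)).entireLFunction 1 ≠ 0 →
    WeierstrassCurve.Affine.Point.map ιK.toRatAlgHom P = heegnerPointComplex Dt H →
    ¬ (p : ℤ) ∣ Dt.c → ¬ IsOfFinAddOrder P →
    Odd (NumberField.discr K) →
    ∀ (κ : ZpExtension K p), κ.IsAnticyclotomic →
      ∀ (γ : Field.absoluteGaloisGroup K) [Fact (κ.IsTopGenerator γ)]
        (𝔭 : HeightOneSpectrum (𝓞 K)), ((p : ℕ) : 𝓞 K) ∈ 𝔭.asIdeal →
        𝔭.asIdeal.ramificationIdx (𝓞 ℚ) = 1 → 𝔭.asIdeal.inertiaDeg (𝓞 ℚ) = 1 →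
        ∀ (𝔭bar : HeightOneSpectrum (𝓞 K)), ((p : ℕ) : 𝓞 K) ∈ 𝔭bar.asIdeal → 𝔭bar ≠ 𝔭 →
          ((Ideal.span {(p : ℤ)}).primesOver (𝓞 K)).ncard = 2 →
        ∀ (f : CuspForm (CongruenceSubgroup.Gamma0 N) 2), IsNewformOf W f →
          ∀ (ι' : PadicAlgCl p ≃+* ℂ),
            (∀ (w : InfinitePlace K) (k : 𝓞 K),
              k ∈ 𝔭.asIdeal ↔ ‖ι'.symm (w.embedding (k : K))‖ < 1) →
            ∀ (ΩK : ℂ) (Ωp : ℂ_[p]) (Q : PowerSeries 𝓞_ℂ_[p]), ΩK ≠ 0 → ‖Ωp‖ = 1 →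
              R1.IsBDPLFunctionInt p ι' 𝔭 κ γ f ΩK Ωp Q →
              ∀ (κ₁ : ZpExtension K p), κ₁.IsCyclotomic →
                ∀ (γ₁ : Field.absoluteGaloisGroup K) [Fact (ZpExtension.IsTopGeneratorPair κ₁ κ γ₁ γ)],
                  Module.Finite (IwasawaAlgebra₂ p) ((W.baseChange K).XGr₂ p κ₁ κ 𝔭bar γ₁ γ) ∧
                  Module.IsTorsion (IwasawaAlgebra₂ p) ((W.baseChange K).XGr₂ p κ₁ κ 𝔭bar γ₁ γ) ∧
                  ∃ (L₂ : PowerSeries (PowerSeries 𝓞_ℂ_[p])) (c e : ℕ) (u : PowerSeries 𝓞_ℂ_[p]),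
                    IsUnit u ∧
                    PowerSeries.C (PowerSeries.C ((p : 𝓞_ℂ_[p]) ^ c)) * L₂ ∈
                      (WeierstrassCurve.XGr₂.charIdeal (W.baseChange K) p κ₁ κ 𝔭bar γ₁ γ).map
                        (PowerSeries.map (PowerSeries.map (R1.toCpInt p))) ∧
                    PowerSeries.constantCoeff L₂ * u = PowerSeries.C ((p : 𝓞_ℂ_[p]) ^ e) * Q

/-- Unfolding lemma: `TwoVarRatDivPNew W p` is by definition the displayed `∀`-statement (for `rw`/`simp only` in consumers that state
the hypothesis in expanded form). [folklore] -/
theorem twoVarRatDivPNew_iff (W : WeierstrassCurve ℚ) [W.IsElliptic] [W.IsGloballyMinimal] (p : ℕ) [Fact p.Prime] :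
    TwoVarRatDivPNew W p ↔
    ∀ (N : ℕ) [NeZero N] (K : Type) [Field K] [NumberField K] (Dt : ModularParametrizationData W N)
      (H : HeegnerDatum N (NumberField.discr K)) (ιK : K →+* ℂ) (P : (W.baseChange K).toAffine.Point),
      CellC W p → W.conductorNorm ℤ = N →
      IsImaginaryQuadratic K → NumberField.discr K < -4 → SatisfiesHeegnerHypothesis N K →
      (W.quadraticTwist (NumberField.discr K : ℚ)).entireLFunction 1 ≠ 0 →
      WeierstrassCurve.Affine.Point.map ιK.toRatAlgHom P = heegnerPointComplex Dt H →
      ¬ (p : ℤ) ∣ Dt.c → ¬ IsOfFinAddOrder P →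
      Odd (NumberField.discr K) →
      ∀ (κ : ZpExtension K p), κ.IsAnticyclotomic →
        ∀ (γ : Field.absoluteGaloisGroup K) [Fact (κ.IsTopGenerator γ)]
          (𝔭 : HeightOneSpectrum (𝓞 K)), ((p : ℕ) : 𝓞 K) ∈ 𝔭.asIdeal →
          𝔭.asIdeal.ramificationIdx (𝓞 ℚ) = 1 → 𝔭.asIdeal.inertiaDeg (𝓞 ℚ) = 1 →
          ∀ (𝔭bar : HeightOneSpectrum (𝓞 K)), ((p : ℕ) : 𝓞 K) ∈ 𝔭bar.asIdeal → 𝔭bar ≠ 𝔭 →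
            ((Ideal.span {(p : ℤ)}).primesOver (𝓞 K)).ncard = 2 →
          ∀ (f : CuspForm (CongruenceSubgroup.Gamma0 N) 2), IsNewformOf W f →
            ∀ (ι' : PadicAlgCl p ≃+* ℂ),
              (∀ (w : InfinitePlace K) (k : 𝓞 K),
                k ∈ 𝔭.asIdeal ↔ ‖ι'.symm (w.embedding (k : K))‖ < 1) →
              ∀ (ΩK : ℂ) (Ωp : ℂ_[p]) (Q : PowerSeries 𝓞_ℂ_[p]), ΩK ≠ 0 → ‖Ωp‖ = 1 →
                R1.IsBDPLFunctionInt p ι' 𝔭 κ γ f ΩK Ωp Q →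
                ∀ (κ₁ : ZpExtension K p), κ₁.IsCyclotomic →
                  ∀ (γ₁ : Field.absoluteGaloisGroup K) [Fact (ZpExtension.IsTopGeneratorPair κ₁ κ γ₁ γ)],
                    Module.Finite (IwasawaAlgebra₂ p) ((W.baseChange K).XGr₂ p κ₁ κ 𝔭bar γ₁ γ) ∧
                    Module.IsTorsion (IwasawaAlgebra₂ p) ((W.baseChange K).XGr₂ p κ₁ κ 𝔭bar γ₁ γ) ∧
                    ∃ (L₂ : PowerSeries (PowerSeries 𝓞_ℂ_[p])) (c e : ℕ) (u : PowerSeries 𝓞_ℂ_[p]),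
                      IsUnit u ∧
                      PowerSeries.C (PowerSeries.C ((p : 𝓞_ℂ_[p]) ^ c)) * L₂ ∈
                        (WeierstrassCurve.XGr₂.charIdeal (W.baseChange K) p κ₁ κ 𝔭bar γ₁ γ).map
                          (PowerSeries.map (PowerSeries.map (R1.toCpInt p))) ∧
                      PowerSeries.constantCoeff L₂ * u = PowerSeries.C ((p : 𝓞_ℂ_[p]) ^ e) * Q :=
  Iff.rfl

end Summit.BirchSwinnertonDyer.BirchSwinnertonDyer.Theorems.EisensteinPrimesBSDpOnCellCAccumDefs

end
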